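import Summits.QuantumFields.YangMills.Theorems.SwapVirialDeficitSectorLaplaceMbDensityFloorDet
import Summits.QuantumFields.YangMills.Theorems.SwapVirialDeficitSectorLaplaceMbDensityDetFolRescaled
import HarnessLib

/-!
# Route `SwapVirialDeficit` (YangMills): THE FLOOR-FORM CEILING OF THE MORSE–BOTT DENSITY IN RESCALED LETTERS — the gnomonic Jacobian `(1+x₀²)(1+y₀²)` GAINED
# on the TIP side: `𝔪(a,ε,p) ≤ ρ(gnoBase p)(1+x₀²)(1+y₀²)∕(√α_z³·det M′·√det A_F(gnoBase p))`
# (cell ym-idea-1, skeleton ➎, `stub_core_tip`: the gnomonic ENDS `|p| → ∞` of the tip∕shell matching must be done in w2 g59's rescaled fibre letters ✓`gnoScale`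
# — in unscaled letters the tip ceiling ✓`mbDensity_angUnit_le_floorDet` decays only like `|p|⁻²` and the comparability constant of ✓`mbDensity_hubAt_comparable`
# grows like `(1+x₀²)²(1+y₀²)²`; free-hands support of ⟨stmt-QuantumFields-24197⟩ `SwapVirialDeficit.SwapGluedStiffness`)

* §1 `lintegral_folFibre_le'` — ✓`lintegral_folFibre_le` for a SINGLE symmetric fibre operator `A₀` whose follower block is a given `λ`-coercive symmetric `A_F⁰`
  (hypothesis `hfol`), so that it applies to the pulled-back operator `S·A(η₀)·S`, `S = gnoScaleLin p` (✓`gnoScale_gnoFolToFibre`: the rescaling fixes the followers).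
* §2 ★★★ `mbDensity_le_of_floorForm_rescaled` — if the PULLED-BACK form `y ↦ Q_{a,ε,p}(gnoScale p y)` dominates a structured floor
  `α_u|u|² + α_v|v|² + c_r((u₁Y − Xv₁)² + (Xv₀ − u₀Y)²) + α_z|z|²` with free cross letters `X, Y` (`α_v, c_r ≥ 0`, `α_z > 0`, `det M′ := α_uα_v + c_r(α_uX² + α_vY²) > 0`),
  then `𝔪(a,ε,p) ≤ ρ(gnoBase p)·(1+x₀²)(1+y₀²)∕(√α_z³·det M′·√det A_F(gnoBase p))` (✓`integral_comp_gnoScale`, then the proof of ✓`mbDensity_le_of_floorForm` verbatim on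
  `S·A(η₀)·S`: block Tonelli, follower completed square, the coupled two-pair Gaussian ✓`lintegral_exp_neg_half_floorBlocks`).
* §3 ★★ `mbDensity_angUnit_le_floorDet_rescaled` — at the hub `angUnit θ` (`cos θ ≠ 0`, `sin θ ≠ 0`) with ✓`fibQ_angUnit_ge_floorForm` read at the rescaled point
  (`u ↦ √(1+x₀²)u`, `v ↦ √(1+y₀²)v`, ✓`gnoScale_apply`): `α_u = ¼·16c²s²(1+x₀²)∕(7200L⁶(1+x₀²))`, `α_v = ¼·4s²(1+y₀²)∕(1800L⁶(1+y₀²))`, `X = x₀√(1+y₀²)`,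
  `Y = √(1+x₀²)y₀` — so `det M′ = s²[c²s² + c²x₀²∕(1+x₀²) + y₀²∕(1+y₀²)]∕(1800L⁶)²`, bounded below UNIFORMLY off the corner, and the weight
  `ρ(gnoBase p)(1+x₀²)(1+y₀²) = (1+x₀²)⁻¹(1+y₀²)⁻¹` is integrable over the whole base.

HONEST LABEL: measure ∕ Gaussian plumbing at fixed `L`; the rescaled shell side, the rescaled comparability, the δ-integration, corner, tip-core and the assembly of `stub_core_tip`,
⟨24197⟩ ∕ ⟨24194⟩ remain OPEN; own crux ⟨22884⟩ `LargeFieldMassRefinementTail` OPEN (blocked-on ⟨19935⟩); the Yang–Mills mass gap is NOT proved; no summit is proved by a line.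
THEOREMS ONLY (0 `def`, 0 `sorry`, no instance), standard axioms.  Width seat ym-line-sfw-p2-w2 g61 (cell ym-idea-1, free hands), `--supports stmt-QuantumFields-24197`.
References: [cite: Breitung1994, Lemma 26]; [cite: Luscher1983, §2]; [folklore].
-/

set_option autoImplicit false
set_option synthInstance.maxSize 1024

noncomputable section

open MeasureTheory Quaternion Set Module
open scoped Quaternion BigOperators ENNReal InnerProductSpace
open Literature.MathematicalPhysics.QuantumLattice
open Literature.MathematicalPhysics.QuantumFieldTheory hiding SU2

namespace Summit.QuantumFields.YangMills.Theorems.SwapVirialDeficit.SectorLaplace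

open Summit.QuantumFields.YangMills.Theorems.FemtoTransferGap
open Summit.QuantumFields.YangMills.Theorems.FemtoTransferGap.TT
open Summit.QuantumFields.YangMills.Theorems.VirialFluxGap.RingDeficit
open Summit.QuantumFields.YangMills.Theorems.SwapVirialDeficit.SwapRing
open Summit.QuantumFields.YangMills.Theorems.SwapVirialDeficit.BlowUpRing
open Summit.QuantumFields.YangMills.Theorems.SwapVirialDeficit.Gnomonic (normSq3 normSq3_nonneg)
open Summit.QuantumFields.YangMills.Theorems.QuantitativeLaplace (integral_exp_neg_mul_half_inner integrable_exp_neg_mul_half_inner inner_pos_of_coercive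
  exists_quadratic_critical quadratic_complete_square integral_exp_neg_half_quadratic_le lintegral_exp_neg_half_pairForm)
open Literature.Analysis.Asymptotics (det_pos_of_inner_pos)

variable {L : ℕ} [NeZero L]

/-! ## §1 The follower fibre bound for a single operator with a prescribed follower block -/

/-- ★ **THE FOLLOWER FIBRE BOUND, OPERATOR FORM**: `A₀` a symmetric operator of `V_L` whose follower block is the symmetric `λ`-coercive `A_F⁰` (`hfol`); for any `x ∈ V_L` and
any floor `m ≤ ⟪A₀(x + ιf), x + ιf⟫` (`ι = gnoFolToFibre`): `∫⁻_f e^{−½⟪A₀(x + ιf), x + ιf⟫} ≤ e^{−m∕2}·(2π)^{d∕2}∕√det A_F⁰` (completing the square over the followers,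
✓`integral_exp_neg_half_quadratic_le`). [cite: Breitung1994, Lemma 26] -/
theorem lintegral_folFibre_le' (A₀ : GnoFibre L →ₗ[ℝ] GnoFibre L) (hA₀s : A₀.IsSymmetric) (AF₀ : GnoFol L →ₗ[ℝ] GnoFol L) (hF₀s : AF₀.IsSymmetric)
    (hfol : ∀ f : GnoFol L, ⟪A₀ (gnoFolToFibre f), gnoFolToFibre f⟫_ℝ = ⟪AF₀ f, f⟫_ℝ)
    {lam : ℝ} (hlam : 0 < lam) (hcoerF : ∀ f : GnoFol L, lam * ‖f‖ ^ 2 ≤ ⟪AF₀ f, f⟫_ℝ) (x : GnoFibre L) {m : ℝ}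
    (hm : ∀ f : GnoFol L, m ≤ ⟪A₀ (x + gnoFolToFibre f), x + gnoFolToFibre f⟫_ℝ) :
    ∫⁻ f : GnoFol L, ENNReal.ofReal (Real.exp (-((1 / 2) * ⟪A₀ (x + gnoFolToFibre f), x + gnoFolToFibre f⟫_ℝ))) ≤
      ENNReal.ofReal (Real.exp (-(m / 2)) * ((2 * Real.pi) ^ ((finrank ℝ (GnoFol L) : ℝ) / 2) / Real.sqrt (LinearMap.det AF₀))) := by
  -- the shifted quadratic in the followers
  set b : GnoFol L := LinearMap.adjoint (gnoFolToFibre (L := L)).toLinearMap (A₀ x) with hb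
  set c : ℝ := ⟪A₀ x, x⟫_ℝ with hc
  have hquad : ∀ f : GnoFol L, ⟪A₀ (x + gnoFolToFibre f), x + gnoFolToFibre f⟫_ℝ = ⟪AF₀ f, f⟫_ℝ + 2 * ⟪b, f⟫_ℝ + c := fun f => by
    have hbf : ⟪b, f⟫_ℝ = ⟪A₀ x, gnoFolToFibre f⟫_ℝ := by
      rw [hb, LinearMap.adjoint_inner_left]; rfl
    have hsym : ⟪A₀ (gnoFolToFibre f), x⟫_ℝ = ⟪A₀ x, gnoFolToFibre f⟫_ℝ := by rw [hA₀s _ x, real_inner_comm]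
    rw [map_add, inner_add_left, inner_add_right, inner_add_right, hfol, hsym, hbf, hc]
    ring
  simp_rw [hquad]
  have hm' : ∀ f : GnoFol L, m ≤ ⟪AF₀ f, f⟫_ℝ + 2 * ⟪b, f⟫_ℝ + c := fun f => by rw [← hquad]; exact hm f
  -- integrability of the shifted Gaussian (complete the square, translate)
  obtain ⟨fs, hfs⟩ := exists_quadratic_critical hlam hcoerF b
  have hint : Integrable fun f : GnoFol L => Real.exp (-((1 / 2) * (⟪AF₀ f, f⟫_ℝ + 2 * ⟪b, f⟫_ℝ + c))) := by
    have e : (fun f : GnoFol L => Real.exp (-((1 / 2) * (⟪AF₀ f, f⟫_ℝ + 2 * ⟪b, f⟫_ℝ + c)))) =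
        fun f => Real.exp (-((1 / 2) * (c - ⟪AF₀ fs, fs⟫_ℝ))) * (fun g : GnoFol L => Real.exp (-(1 * ((1 / 2) * ⟪AF₀ g, g⟫_ℝ)))) (f - fs) := by
      funext f
      rw [quadratic_complete_square hF₀s hfs c f, ← Real.exp_add]
      congr 1; ring
    rw [e]
    exact ((integrable_exp_neg_mul_half_inner hlam hcoerF one_pos).comp_sub_right fs).const_mul _
  rw [← ofReal_integral_eq_lintegral_ofReal hint (ae_of_all _ fun f => (Real.exp_pos _).le)]
  exact ENNReal.ofReal_le_ofReal (integral_exp_neg_half_quadratic_le hF₀s hlam hcoerF b c hm')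

/-! ## §2 The rescaled upper bound -/

set_option maxHeartbeats 1600000 in
/-- ★★★ **THE FLOOR-FORM CEILING IN RESCALED LETTERS.**  Hub `a` with `re a ≠ 0`, `im a ≠ 0`, good signs, base point `p = (x₀,y₀)`; `A_F` a symmetric follower family with the
form identity at the hub `a`; a structured floor of the PULLED-BACK form `y ↦ Q_{a,ε,p}(gnoScale p y)` in the leader letters with free cross letters `X, Y`, `α_v, c_r ≥ 0`,
`α_z > 0`, `det M′ = α_uα_v + c_r(α_uX² + α_vY²) > 0`.  Then `𝔪(a,ε,p) ≤ ρ(gnoBase p)·(1+x₀²)(1+y₀²)∕(√α_z³·det M′·√det A_F(gnoBase p))`.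
[cite: Breitung1994, Lemma 26] [cite: Luscher1983, §2] -/
theorem mbDensity_le_of_floorForm_rescaled {a : ℍ} (hre : a.re ≠ 0) (him : a.im ≠ 0) {ε : GnoSign L} (hε : GoodSign ε) (p : ℝ × ℝ)
    {AF : GnoCoord L → GnoFol L →ₗ[ℝ] GnoFol L} (hFs : ∀ η, (AF η).IsSymmetric)
    (hFyy : ∀ η (y : GnoFol L), ⟪AF η y, y⟫_ℝ = iteratedFDeriv ℝ 2 (fun y' : GnoFol L => gnoDeficit z₀ (fun _ => 1) a ε (η + gnoFolEmb y')) 0 (fun _ => y))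
    {αu αv cr αz X Y : ℝ} (hαv : 0 ≤ αv) (hcr : 0 ≤ cr) (hαz : 0 < αz) (hdet : 0 < αu * αv + cr * (αu * X ^ 2 + αv * Y ^ 2))
    (hfloor : ∀ y : GnoFibre L, αu * (y (Sum.inl (Sum.inl 0)) ^ 2 + y (Sum.inl (Sum.inl 1)) ^ 2) + αv * (y (Sum.inl (Sum.inr 0)) ^ 2 + y (Sum.inl (Sum.inr 1)) ^ 2) +
        cr * ((y (Sum.inl (Sum.inl 1)) * Y - X * y (Sum.inl (Sum.inr 1))) ^ 2 + (X * y (Sum.inl (Sum.inr 0)) - y (Sum.inl (Sum.inl 0)) * Y) ^ 2) +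
        αz * (∑ k, y (Sum.inr (Sum.inl k)) ^ 2) ≤ fibQ a ε p (gnoScale p y)) :
    mbDensity (L := L) a ε p ≤ gnoDensity (gnoBase p.1 p.2 : GnoCoord L) * ((1 + p.1 ^ 2) * (1 + p.2 ^ 2)) /
      (Real.sqrt αz ^ 3 * (αu * αv + cr * (αu * X ^ 2 + αv * Y ^ 2)) * Real.sqrt (LinearMap.det (AF (gnoBase p.1 p.2)))) := by
  have ha : a ≠ 0 := fun h => hre (by rw [h]; rfl)
  have hL : (0 : ℝ) < (L : ℝ) := Nat.cast_pos.2 (Nat.pos_of_ne_zero (NeZero.ne L))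
  set η₀ : GnoCoord L := gnoBase p.1 p.2 with hη₀
  set detM : ℝ := αu * αv + cr * (αu * X ^ 2 + αv * Y ^ 2) with hdetM
  -- dimensions (opaque)
  have hd9 := nine_le_finrank_gnoFol (L := L)
  obtain ⟨d, hd⟩ : ∃ d : ℝ, (finrank ℝ (GnoFol L) : ℝ) = d := ⟨_, rfl⟩
  rw [hd] at hd9
  have hdpos : 0 < d := by linarith
  have hdn : (finrank ℝ (GnoFol L) : ℝ) = 3 * (Fintype.card (Fol L) : ℝ) := finrank_gnoFol_real (L := L)
  have hdimL : (finrank ℝ (GnoFibre L) : ℝ) = 7 + d := by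
    rw [← hd, hdn]
    have h := card_gnoFibreIdx (L := L)
    rw [finrank_euclideanSpace, h]; push_cast; ring
  -- the fibre Hessian at η₀, the pulled-back operator `A'' = S A(η₀) S` and the quadratic form
  obtain ⟨A, hAs, -, hAyy, hAray, -, -, -⟩ := exists_gnoFibreHessian z₀ (fun _ => 1) ha ε
  have hQ0 : ∀ y : GnoFibre L, fibQ a ε p y = ⟪A η₀ y, y⟫_ℝ := fun y => (hAray η₀ y).symm
  set A'' : GnoFibre L →ₗ[ℝ] GnoFibre L := (gnoScaleLin (L := L) p) ∘ₗ (A η₀) ∘ₗ (gnoScaleLin (L := L) p) with hA''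
  have hSsym := gnoScaleLin_isSymmetric (L := L) p
  have hA''app : ∀ y : GnoFibre L, A'' y = gnoScale p (A η₀ (gnoScale p y)) := fun y => rfl
  have hA''yw : ∀ y w : GnoFibre L, ⟪A'' y, w⟫_ℝ = ⟪A η₀ (gnoScale p y), gnoScale p w⟫_ℝ := fun y w => by
    rw [hA''app, ← gnoScaleLin_apply, ← gnoScaleLin_apply, ← gnoScaleLin_apply, hSsym]
  have hA''s : A''.IsSymmetric := fun v w => by
    show ⟪gnoScaleLin p (A η₀ (gnoScaleLin p v)), w⟫_ℝ = ⟪v, gnoScaleLin p (A η₀ (gnoScaleLin p w))⟫_ℝ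
    rw [hSsym, hAs η₀, ← hSsym]
  have hQ : ∀ y : GnoFibre L, fibQ a ε p (gnoScale p y) = ⟪A'' y, y⟫_ℝ := fun y => by rw [hA''yw, hQ0]
  -- coercivity of the follower block
  set lam : ℝ := min (min (2 * (2 * (‖a‖⁻¹ * a.re) * (‖a‖⁻¹ * ‖a.im‖)) ^ 2 / ((2 + p.1 ^ 2) * (16200 * (L : ℝ) ^ 6)))
        (2 * (‖a‖⁻¹ * ‖a.im‖) ^ 2 / ((2 + p.2 ^ 2) * (16200 * (L : ℝ) ^ 6))))
      (min (1 / (16200 * (L : ℝ) ^ 6)) ((2304 * (L : ℝ) ^ 6 * (Fintype.card (Fol L) : ℝ))⁻¹ / 2)) with hlam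
  have hlampos : 0 < lam := lam_explicit_pos hre him p
  have hcoerA0 : ∀ y : GnoFibre L, lam * ‖y‖ ^ 2 ≤ ⟪A η₀ y, y⟫_ℝ := fun y => by rw [← hQ0]; exact fibQ_coercive_explicit hre him hε p y
  have hfol0 : ∀ f : GnoFol L, ⟪A η₀ (gnoFolToFibre f), gnoFolToFibre f⟫_ℝ = ⟪AF η₀ f, f⟫_ℝ := fun f =>
    inner_gnoFibreHessian_fol z₀ (fun _ => 1) ha ε hAyy hFyy η₀ f
  have hfol : ∀ f : GnoFol L, ⟪A'' (gnoFolToFibre f), gnoFolToFibre f⟫_ℝ = ⟪AF η₀ f, f⟫_ℝ := fun f => by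
    rw [hA''yw, gnoScale_gnoFolToFibre, hfol0]
  have hcoerF : ∀ f : GnoFol L, lam * ‖f‖ ^ 2 ≤ ⟪AF η₀ f, f⟫_ℝ := fun f => by
    rw [← hfol0, ← norm_gnoFolToFibre f]; exact hcoerA0 _
  have hdetF : 0 < LinearMap.det (AF η₀) := det_pos_of_inner_pos (hFs η₀) (inner_pos_of_coercive hlampos hcoerF)
  -- the block maps
  set E : GnoFibre L ≃ᵐ ((Fin 2 → ℝ) × (Fin 2 → ℝ)) × (Fin 3 → ℝ) × (Fol L → Fin 3 → ℝ) := gnoFibreBlocksEquiv (L := L) with hE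
  set ι₁ : ((Fin 2 → ℝ) × (Fin 2 → ℝ)) × (Fin 3 → ℝ) → GnoFibre L := fun ℓ => E.symm (ℓ.1, (ℓ.2, (0 : Fol L → Fin 3 → ℝ))) with hι₁
  set ι₂ : (Fol L → Fin 3 → ℝ) → GnoFibre L := fun F => E.symm (((0 : Fin 2 → ℝ), (0 : Fin 2 → ℝ)), ((0 : Fin 3 → ℝ), F)) with hι₂
  have hEadd : ∀ y y' : GnoFibre L, E (y + y') = E y + E y' := fun y y' => by
    show gnoFibreBlocks (y + y') = gnoFibreBlocks y + gnoFibreBlocks y'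
    rfl
  have hdecomp : ∀ (ℓ : ((Fin 2 → ℝ) × (Fin 2 → ℝ)) × (Fin 3 → ℝ)) (F : Fol L → Fin 3 → ℝ), E.symm (ℓ.1, (ℓ.2, F)) = ι₁ ℓ + ι₂ F := fun ℓ F => by
    apply E.injective
    rw [hEadd, hι₁, hι₂, E.apply_symm_apply, E.apply_symm_apply, E.apply_symm_apply]
    simp
  have hι₂fol : ∀ f : GnoFol L, ι₂ (gnoFolBlocksEquiv f) = gnoFolToFibre f := fun f => by
    rw [hι₂]
    apply E.injective
    rw [E.apply_symm_apply, hE, gnoFibreBlocksEquiv_apply, gnoFibreBlocks_gnoFolToFibre, gnoFolBlocksEquiv_apply]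
  -- the completed-square letters of the floor
  set Aq : ℝ := αu + cr * Y ^ 2 with hAq
  set Bq : ℝ := cr * X * Y with hBq
  set Cq : ℝ := αv + cr * X ^ 2 with hCq
  have hDq : Aq * Cq - Bq ^ 2 = detM := by rw [hAq, hBq, hCq, hdetM]; ring
  have hCqpos : 0 < Cq := by
    rcases hαv.lt_or_eq with hv | hv
    · rw [hCq]; positivity
    · -- `αv = 0`: then `det M′ = cr·αu·X² > 0` forces `cr > 0`, `X ≠ 0`
      rw [hCq, ← hv, zero_add]
      rw [hdetM, ← hv] at hdet
      have h1 : 0 < cr * (αu * X ^ 2) := by nlinarith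
      have hcr' : 0 < cr := by
        rcases hcr.lt_or_eq with h | h
        · exact h
        · rw [← h, zero_mul] at h1; exact absurd h1 (lt_irrefl 0)
      have hx : 0 < X ^ 2 := by
        rcases (sq_nonneg X).lt_or_eq with h | h
        · exact h
        · rw [← h, mul_zero, mul_zero] at h1; exact absurd h1 (lt_irrefl 0)
      positivity
  have hDqpos : 0 < Aq * Cq - Bq ^ 2 := by rw [hDq]; exact hdet
  -- the floor at fixed leader letters, in completed-square form
  set mℓ : (((Fin 2 → ℝ) × (Fin 2 → ℝ)) × (Fin 3 → ℝ)) → ℝ := fun ℓ =>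
    (∑ j, (Aq * ℓ.1.1 j ^ 2 - 2 * Bq * ℓ.1.1 j * ℓ.1.2 j + Cq * ℓ.1.2 j ^ 2)) + αz * ∑ k, ℓ.2 k ^ 2 with hmℓ
  have hfloorℓ : ∀ (ℓ : ((Fin 2 → ℝ) × (Fin 2 → ℝ)) × (Fin 3 → ℝ)) (f : GnoFol L), mℓ ℓ ≤ ⟪A'' (ι₁ ℓ + gnoFolToFibre f), ι₁ ℓ + gnoFolToFibre f⟫_ℝ := by
    intro ℓ f
    rw [← hQ, ← hι₂fol, ← hdecomp ℓ (gnoFolBlocksEquiv f)]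
    obtain ⟨hu, hv, hz⟩ := gnoFibreBlocksEquiv_symm_letters (L := L) ℓ (gnoFolBlocksEquiv f)
    have h := hfloor (E.symm (ℓ.1, (ℓ.2, gnoFolBlocksEquiv f)))
    rw [hE] at h ⊢
    rw [hu 0, hu 1, hv 0, hv 1] at h
    simp only [hz] at h
    refine le_trans (le_of_eq ?_) h
    simp only [hmℓ, Fin.sum_univ_two, hAq, hBq, hCq]
    ring
  -- §A the rescaled fibre integral in block letters
  have hmS : Measurable fun y : GnoFibre L => gnoScale (L := L) p y := by
    have h := Measurable.comp (measurable_gnoScale_prod (L := L)) ((measurable_const (a := p)).prodMk (measurable_id (α := GnoFibre L)))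
    exact h
  have hmQS : Measurable fun y : GnoFibre L => fibQ a ε p (gnoScale p y) := by
    have h := Measurable.comp (measurable_fibQ ha ε p) hmS
    exact h
  have hintS : Integrable fun y : GnoFibre L => Real.exp (-(fibQ a ε p (gnoScale p y) / 2)) := by
    have hmeas : AEStronglyMeasurable (fun y : GnoFibre L => Real.exp (-(fibQ a ε p (gnoScale p y) / 2))) volume :=
      (Real.measurable_exp.comp (hmQS.div_const 2).neg).aestronglyMeasurable
    refine (Literature.Analysis.Asymptotics.integrable_exp_neg_mul_norm_sq (V := GnoFibre L) (c := lam / 2) (by positivity)).mono hmeas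
      (Filter.Eventually.of_forall fun y => ?_)
    rw [Real.norm_eq_abs, Real.norm_eq_abs, abs_of_pos (Real.exp_pos _), abs_of_pos (Real.exp_pos _)]
    refine Real.exp_le_exp.2 ?_
    have h1 := hcoerA0 (gnoScale p y)
    rw [← hQ0] at h1
    have h2 := norm_le_norm_gnoScale p y
    have h3 : ‖y‖ ^ 2 ≤ ‖gnoScale p y‖ ^ 2 := by nlinarith [norm_nonneg y]
    nlinarith [hlampos]
  have hIeq : ENNReal.ofReal (∫ y : GnoFibre L, Real.exp (-(fibQ a ε p (gnoScale p y) / 2))) =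
      ∫⁻ ℓ : ((Fin 2 → ℝ) × (Fin 2 → ℝ)) × (Fin 3 → ℝ), ∫⁻ F : Fol L → Fin 3 → ℝ,
        ENNReal.ofReal (Real.exp (-((1 / 2) * ⟪A'' (ι₁ ℓ + ι₂ F), ι₁ ℓ + ι₂ F⟫_ℝ))) := by
    have hGm : Measurable fun y : GnoFibre L => ENNReal.ofReal (Real.exp (-(fibQ a ε p (gnoScale p y) / 2))) :=
      ENNReal.measurable_ofReal.comp (Real.measurable_exp.comp (hmQS.div_const 2).neg)
    rw [ofReal_integral_eq_lintegral_ofReal hintS (ae_of_all _ fun y => (Real.exp_pos _).le), lintegral_gnoFibre_eq_blocks _ hGm]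
    refine lintegral_congr fun ℓ => lintegral_congr fun F => ?_
    rw [← hE, hdecomp ℓ F, hQ]; ring_nf
  -- §B the follower fibre at fixed ℓ
  have hfib : ∀ ℓ : ((Fin 2 → ℝ) × (Fin 2 → ℝ)) × (Fin 3 → ℝ),
      ∫⁻ F : Fol L → Fin 3 → ℝ, ENNReal.ofReal (Real.exp (-((1 / 2) * ⟪A'' (ι₁ ℓ + ι₂ F), ι₁ ℓ + ι₂ F⟫_ℝ))) ≤
        ENNReal.ofReal (Real.exp (-(mℓ ℓ / 2)) * ((2 * Real.pi) ^ (d / 2) / Real.sqrt (LinearMap.det (AF η₀)))) := fun ℓ => by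
    have hmeasF : Measurable fun F : Fol L → Fin 3 → ℝ => ENNReal.ofReal (Real.exp (-((1 / 2) * ⟪A'' (ι₁ ℓ + ι₂ F), ι₁ ℓ + ι₂ F⟫_ℝ))) := by
      have hFι : Measurable fun F : Fol L → Fin 3 → ℝ => (ℓ.1, (ℓ.2, F)) := measurable_const.prodMk (measurable_const.prodMk measurable_id)
      have hy : Measurable fun F : Fol L → Fin 3 → ℝ => E.symm (ℓ.1, (ℓ.2, F)) := E.symm.measurable.comp hFι
      have hq : Measurable fun F : Fol L → Fin 3 → ℝ => fibQ a ε p (gnoScale p (E.symm (ℓ.1, (ℓ.2, F)))) := hmQS.comp hy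
      have e : (fun F : Fol L → Fin 3 → ℝ => ENNReal.ofReal (Real.exp (-((1 / 2) * ⟪A'' (ι₁ ℓ + ι₂ F), ι₁ ℓ + ι₂ F⟫_ℝ)))) =
          fun F => ENNReal.ofReal (Real.exp (-((1 / 2) * fibQ a ε p (gnoScale p (E.symm (ℓ.1, (ℓ.2, F))))))) := by
        funext F; rw [hQ, hdecomp ℓ F]
      rw [e]
      exact ENNReal.measurable_ofReal.comp (Real.measurable_exp.comp (hq.const_mul _).neg)
    rw [← (volume_preserving_gnoFolBlocksEquiv (L := L)).lintegral_comp hmeasF, ← hd]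
    calc ∫⁻ f : GnoFol L, ENNReal.ofReal (Real.exp (-((1 / 2) * ⟪A'' (ι₁ ℓ + ι₂ (gnoFolBlocksEquiv f)), ι₁ ℓ + ι₂ (gnoFolBlocksEquiv f)⟫_ℝ)))
        = ∫⁻ f : GnoFol L, ENNReal.ofReal (Real.exp (-((1 / 2) * ⟪A'' (ι₁ ℓ + gnoFolToFibre f), ι₁ ℓ + gnoFolToFibre f⟫_ℝ))) :=
          lintegral_congr fun f => by rw [hι₂fol]
      _ ≤ _ := lintegral_folFibre_le' A'' hA''s (AF η₀) (hFs η₀) hfol hlampos hcoerF (ι₁ ℓ) (hfloorℓ ℓ)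
  -- §C the seven-letter Gaussian
  have hKF : 0 < (2 * Real.pi) ^ (d / 2) / Real.sqrt (LinearMap.det (AF η₀)) := by positivity
  have hmℓmeas : Measurable fun ℓ : ((Fin 2 → ℝ) × (Fin 2 → ℝ)) × (Fin 3 → ℝ) => ENNReal.ofReal (Real.exp (-(mℓ ℓ / 2))) := by
    refine ENNReal.measurable_ofReal.comp (Real.measurable_exp.comp (Measurable.neg (Measurable.div_const ?_ _)))
    rw [hmℓ]
    refine (Finset.measurable_sum _ fun j _ => ?_).add ((Finset.measurable_sum _ fun k _ => ((measurable_pi_apply k).comp measurable_snd).pow_const 2).const_mul _)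
    have h1 : Measurable fun q : ((Fin 2 → ℝ) × (Fin 2 → ℝ)) × (Fin 3 → ℝ) => q.1.1 j := (measurable_pi_apply j).comp (measurable_fst.comp measurable_fst)
    have h2 : Measurable fun q : ((Fin 2 → ℝ) × (Fin 2 → ℝ)) × (Fin 3 → ℝ) => q.1.2 j := (measurable_pi_apply j).comp (measurable_snd.comp measurable_fst)
    exact (((h1.pow_const 2).const_mul Aq).sub (((h1.const_mul (2 * Bq)).mul h2))).add ((h2.pow_const 2).const_mul Cq)
  have hseven : ∫⁻ ℓ : ((Fin 2 → ℝ) × (Fin 2 → ℝ)) × (Fin 3 → ℝ), ENNReal.ofReal (Real.exp (-(mℓ ℓ / 2))) =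
      ENNReal.ofReal ((2 * Real.pi / Real.sqrt (Aq * Cq - Bq ^ 2)) ^ 2) * ENNReal.ofReal (Real.sqrt (Real.pi / (αz / 2)) ^ 3) := by
    rw [← lintegral_exp_neg_half_floorBlocks hCqpos hDqpos hαz]
    refine lintegral_congr fun ℓ => ?_
    simp only [hmℓ]
    congr 2
    ring
  -- §D the chain in `ℝ≥0∞`
  have hchain : ENNReal.ofReal (∫ y : GnoFibre L, Real.exp (-(fibQ a ε p (gnoScale p y) / 2))) ≤
      ENNReal.ofReal ((2 * Real.pi / Real.sqrt (Aq * Cq - Bq ^ 2)) ^ 2) * ENNReal.ofReal (Real.sqrt (Real.pi / (αz / 2)) ^ 3) *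
        ENNReal.ofReal ((2 * Real.pi) ^ (d / 2) / Real.sqrt (LinearMap.det (AF η₀))) := by
    rw [hIeq]
    calc ∫⁻ ℓ : ((Fin 2 → ℝ) × (Fin 2 → ℝ)) × (Fin 3 → ℝ), ∫⁻ F : Fol L → Fin 3 → ℝ,
          ENNReal.ofReal (Real.exp (-((1 / 2) * ⟪A'' (ι₁ ℓ + ι₂ F), ι₁ ℓ + ι₂ F⟫_ℝ)))
        ≤ ∫⁻ ℓ : ((Fin 2 → ℝ) × (Fin 2 → ℝ)) × (Fin 3 → ℝ), ENNReal.ofReal (Real.exp (-(mℓ ℓ / 2))) *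
            ENNReal.ofReal ((2 * Real.pi) ^ (d / 2) / Real.sqrt (LinearMap.det (AF η₀))) := by
          refine lintegral_mono fun ℓ => ?_
          rw [← ENNReal.ofReal_mul (Real.exp_pos _).le]
          exact hfib ℓ
      _ = (∫⁻ ℓ : ((Fin 2 → ℝ) × (Fin 2 → ℝ)) × (Fin 3 → ℝ), ENNReal.ofReal (Real.exp (-(mℓ ℓ / 2)))) *
            ENNReal.ofReal ((2 * Real.pi) ^ (d / 2) / Real.sqrt (LinearMap.det (AF η₀))) := lintegral_mul_const _ hmℓmeas
      _ = _ := by rw [hseven]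
  -- back to `ℝ`
  have hIpos : 0 ≤ ∫ y : GnoFibre L, Real.exp (-(fibQ a ε p (gnoScale p y) / 2)) := integral_nonneg fun y => (Real.exp_pos _).le
  rw [← ENNReal.ofReal_mul (by positivity), ← ENNReal.ofReal_mul (by positivity)] at hchain
  have hreal := (ENNReal.ofReal_le_ofReal_iff (by positivity)).1 hchain
  rw [hDq] at hreal
  -- the change of variables `∫ e^{−Q/2} = (1+x₀²)(1+y₀²)·∫ e^{−Q∘S/2}` and the normalisation `(2π)^{−α}`
  have hmg : Measurable fun y : GnoFibre L => Real.exp (-(fibQ a ε p y / 2)) := Real.measurable_exp.comp ((measurable_fibQ ha ε p).div_const 2).neg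
  have hcov := integral_comp_gnoScale p hmg (fun y => (Real.exp_pos _).le)
  have hρ : 0 ≤ gnoDensity (gnoBase p.1 p.2 : GnoCoord L) := (gnoDensity_pos _).le
  have hJ : 0 ≤ (1 + p.1 ^ 2) * (1 + p.2 ^ 2) := by positivity
  have h2pipos : 0 < (2 * Real.pi) ^ ((7 + d) / 2) := by positivity
  rw [div_eq_mul_inv]
  unfold mbDensity alpha
  rw [hdimL, hcov]
  rw [show gnoDensity (gnoBase p.1 p.2 : GnoCoord L) * ((2 * Real.pi) ^ ((7 + d) / 2))⁻¹ *
      ((1 + p.1 ^ 2) * (1 + p.2 ^ 2) * ∫ y : GnoFibre L, Real.exp (-(fibQ a ε p (gnoScale p y) / 2))) =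
      gnoDensity (gnoBase p.1 p.2 : GnoCoord L) * ((1 + p.1 ^ 2) * (1 + p.2 ^ 2)) *
        (((2 * Real.pi) ^ ((7 + d) / 2))⁻¹ * ∫ y : GnoFibre L, Real.exp (-(fibQ a ε p (gnoScale p y) / 2))) by ring]
  refine mul_le_mul_of_nonneg_left ?_ (mul_nonneg hρ hJ)
  refine le_trans (mul_le_mul_of_nonneg_left hreal (by positivity)) (le_of_eq ?_)
  -- the powers of `2π` cancel
  set S : ℝ := Real.sqrt (2 * Real.pi) with hS
  have hSpos : 0 < S := by rw [hS]; positivity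
  have hS2 : 2 * Real.pi = S ^ 2 := by rw [hS, Real.sq_sqrt (by positivity)]
  have hS7 : (2 * Real.pi) ^ ((7 + d) / 2) = S ^ 7 * (2 * Real.pi) ^ (d / 2) := by
    rw [show (7 + d) / 2 = (7 : ℝ) / 2 + d / 2 by ring, Real.rpow_add (by positivity)]
    congr 1
    rw [hS, Real.sqrt_eq_rpow, ← Real.rpow_natCast, ← Real.rpow_mul (by positivity)]
    norm_num
  have hZ : Real.sqrt (Real.pi / (αz / 2)) = S / Real.sqrt αz := by
    rw [hS, ← Real.sqrt_div (by positivity)]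
    congr 1; field_simp
  have hsqαz : 0 < Real.sqrt αz := Real.sqrt_pos.2 hαz
  have hsqdet : 0 < Real.sqrt (LinearMap.det (AF η₀)) := Real.sqrt_pos.2 hdetF
  have hsqM : Real.sqrt detM ^ 2 = detM := Real.sq_sqrt hdet.le
  have hsqMpos : 0 < Real.sqrt detM := Real.sqrt_pos.2 hdet
  have hX : 0 < (2 * Real.pi) ^ (d / 2) := by positivity
  have h4 : (2 * Real.pi) ^ 2 = S ^ 4 := by rw [hS2]; ring
  have hSne : S ≠ 0 := hSpos.ne'
  have hXne : (2 * Real.pi) ^ (d / 2) ≠ 0 := hX.ne'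
  have hαne : Real.sqrt αz ≠ 0 := hsqαz.ne'
  have hdne : Real.sqrt (LinearMap.det (AF η₀)) ≠ 0 := hsqdet.ne'
  have hMne : detM ≠ 0 := hdet.ne'
  rw [hS7, hZ, div_pow, div_pow, hsqM, h4]
  field_simp

/-! ## §3 At the tip hub `angUnit θ`: memo3's structured floor in rescaled letters -/

omit [NeZero L] in
/-- The leader letters of the rescaled vector: `u ↦ √(1+x₀²)u`, `v ↦ √(1+y₀²)v`, `z ↦ z`. [folklore] -/
theorem gnoScale_letters (p : ℝ × ℝ) (y : GnoFibre L) :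
    (∀ j, gnoScale p y (Sum.inl (Sum.inl j)) = Real.sqrt (1 + p.1 ^ 2) * y (Sum.inl (Sum.inl j))) ∧
    (∀ j, gnoScale p y (Sum.inl (Sum.inr j)) = Real.sqrt (1 + p.2 ^ 2) * y (Sum.inl (Sum.inr j))) ∧
    (∀ k, gnoScale p y (Sum.inr (Sum.inl k)) = y (Sum.inr (Sum.inl k))) := by
  refine ⟨fun j => ?_, fun j => ?_, fun k => ?_⟩
  · rw [gnoScale_apply]; rfl
  · rw [gnoScale_apply]; rfl
  · rw [gnoScale_apply]; show (1 : ℝ) * _ = _; rw [one_mul]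

/-- ★★ **THE RESCALED TIP-SIDE CEILING** (memo3 §6 in ✓`gnoScale` letters): at the hub `angUnit θ` (`cos θ ≠ 0`, `sin θ ≠ 0`), good signs, base point `p`, and any symmetric
follower family `A_F` with the form identity at `angUnit θ`: `𝔪(angUnit θ, ε, p) ≤ ρ(gnoBase p)(1+x₀²)(1+y₀²)∕(√α_z³·det M′·√det A_F(gnoBase p))` with
`α_u = ¼·(16c²s²∕(7200L⁶(1+x₀²)))·√(1+x₀²)²`, `α_v = ¼·(4s²∕(1800L⁶(1+y₀²)))·√(1+y₀²)²`, `c_r = ¼·4∕(1800L⁶(1+x₀²)(1+y₀²))`, `α_z = ¼·(1800L⁶)⁻¹`, cross letters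
`X = x₀√(1+y₀²)`, `Y = √(1+x₀²)y₀` (✓`fibQ_angUnit_ge_floorForm` at `gnoScale p y`). [cite: Luscher1983, §2] [cite: Breitung1994, Lemma 26] -/
theorem mbDensity_angUnit_le_floorDet_rescaled {θ : ℝ} (hc : Real.cos θ ≠ 0) (hs : Real.sin θ ≠ 0) {ε : GnoSign L} (hε : GoodSign ε) (p : ℝ × ℝ)
    {AF : GnoCoord L → GnoFol L →ₗ[ℝ] GnoFol L} (hFs : ∀ η, (AF η).IsSymmetric)
    (hFyy : ∀ η (y : GnoFol L), ⟪AF η y, y⟫_ℝ = iteratedFDeriv ℝ 2 (fun y' : GnoFol L => gnoDeficit z₀ (fun _ => 1) (angUnit θ) ε (η + gnoFolEmb y')) 0 (fun _ => y)) :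
    mbDensity (L := L) (angUnit θ) ε p ≤ gnoDensity (gnoBase p.1 p.2 : GnoCoord L) * ((1 + p.1 ^ 2) * (1 + p.2 ^ 2)) /
      (Real.sqrt ((1 / 4 : ℝ) * (1 / (1800 * (L : ℝ) ^ 6))) ^ 3 *
        (((1 / 4 : ℝ) * (16 * Real.cos θ ^ 2 * Real.sin θ ^ 2 / ((7200 * (L : ℝ) ^ 6) * (1 + p.1 ^ 2))) * Real.sqrt (1 + p.1 ^ 2) ^ 2) *
            ((1 / 4 : ℝ) * (4 * Real.sin θ ^ 2 / ((1800 * (L : ℝ) ^ 6) * (1 + p.2 ^ 2))) * Real.sqrt (1 + p.2 ^ 2) ^ 2) +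
          ((1 / 4 : ℝ) * (4 / ((1800 * (L : ℝ) ^ 6) * ((1 + p.1 ^ 2) * (1 + p.2 ^ 2))))) *
            (((1 / 4 : ℝ) * (16 * Real.cos θ ^ 2 * Real.sin θ ^ 2 / ((7200 * (L : ℝ) ^ 6) * (1 + p.1 ^ 2))) * Real.sqrt (1 + p.1 ^ 2) ^ 2) *
                (p.1 * Real.sqrt (1 + p.2 ^ 2)) ^ 2 +
              ((1 / 4 : ℝ) * (4 * Real.sin θ ^ 2 / ((1800 * (L : ℝ) ^ 6) * (1 + p.2 ^ 2))) * Real.sqrt (1 + p.2 ^ 2) ^ 2) *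
                (Real.sqrt (1 + p.1 ^ 2) * p.2) ^ 2)) *
        Real.sqrt (LinearMap.det (AF (gnoBase p.1 p.2)))) := by
  have hL : (0 : ℝ) < (L : ℝ) := Nat.cast_pos.2 (Nat.pos_of_ne_zero (NeZero.ne L))
  have hre : (angUnit θ).re ≠ 0 := by rw [angUnit_re]; exact hc
  have him : (angUnit θ).im ≠ 0 := angUnit_im_ne_zero hs
  have hX1 : 0 < Real.sqrt (1 + p.1 ^ 2) := Real.sqrt_pos.2 (by positivity)
  have hY1 : 0 < Real.sqrt (1 + p.2 ^ 2) := Real.sqrt_pos.2 (by positivity)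
  have hαu : 0 < (1 / 4 : ℝ) * (16 * Real.cos θ ^ 2 * Real.sin θ ^ 2 / ((7200 * (L : ℝ) ^ 6) * (1 + p.1 ^ 2))) * Real.sqrt (1 + p.1 ^ 2) ^ 2 := by positivity
  have hαv : 0 < (1 / 4 : ℝ) * (4 * Real.sin θ ^ 2 / ((1800 * (L : ℝ) ^ 6) * (1 + p.2 ^ 2))) * Real.sqrt (1 + p.2 ^ 2) ^ 2 := by positivity
  have hcr : 0 ≤ (1 / 4 : ℝ) * (4 / ((1800 * (L : ℝ) ^ 6) * ((1 + p.1 ^ 2) * (1 + p.2 ^ 2)))) := by positivity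
  have hαz : 0 < (1 / 4 : ℝ) * (1 / (1800 * (L : ℝ) ^ 6)) := by positivity
  refine mbDensity_le_of_floorForm_rescaled hre him hε p hFs hFyy hαv.le hcr hαz (by positivity) fun y => ?_
  have h := fibQ_angUnit_ge_floorForm θ ε hε.1 hε.2 p (gnoScale p y)
  obtain ⟨hu, hv, hz⟩ := gnoScale_letters (L := L) p y
  rw [hu 0, hu 1, hv 0, hv 1] at h
  simp only [hz] at h
  refine le_trans (le_of_eq ?_) h
  ring

end Summit.QuantumFields.YangMills.Theorems.SwapVirialDeficit.SectorLaplace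

end
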